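import Summits.CriticalPhenomena.PercolationContinuityZ3.Theses.PercNearOneGluing
import Literature.Probability.Percolation.PercolationEvents
import HarnessLib.Audit
import Summits.CriticalPhenomena.PercolationContinuityZ3.Theorems.PercNearOneGluingAdditiveGluingTieLiftOne
import Literature.Probability.Percolation.TwoClusterConditionalAssociationProofs
import Literature.Probability.LatticeModels.ProdBernoulliIndependence

/-! TTRL-lite variant V2411 of stmt-CriticalPhenomena-4574 -/

/-!
# Kozma–Nitzan's shortening step (Conjecture 6) for TWO relays

Variant V2411 (`A.card = 2`) of the kernel stub `stub_shorteningStep` of the line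
`kn_shortening_induction` for the crux `PercNearOneGluing.NearOneGluing` (stmt-CriticalPhenomena-4574):
for a weight function `w` on the pairs of `Fin n`, a relay set `A = {a₀, a₁}`, a target `b`, a source `v` and a
second vertex `x ≠ v` with `w s(v,x) = 0`, and `a₀` a minimiser of `a ↦ P_w(a ↔ b)` on `A`, the contracted
weights `w₁ := w[s(v,x) ↦ 1]` satisfy `P_{w₁}(v ↔ A) · P_{w₁}(a₀ ↔ b) ≤ P_{w₁}(v ↔ b)` (Kozma–Nitzan,
arXiv:2401.12397, Conjecture 6 / (40), the case of two relays, measured against the OLD minimiser).  The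
displayed induction hypothesis of the stub is not needed.

## Proof

Write `μ = prodBernoulli w` and realise `μ₁ = prodBernoulli w₁` as the image of `μ` under `ω ↦ insert e ω`,
`e = s(v,x)` (`tieLiftOne_real_one_eq`).  With `E, F, B` the preimages of `{v ↔ A}`, `{a₀ ↔ b}`, `{v ↔ b}`,
Harris gives `μ(E) μ(F) ≤ μ(E ∩ F)`, and it remains to show `μ((E ∩ F) ∖ B) ≤ μ(B ∖ (E ∩ F))`.  Splitting
glued paths at the inserted pair (`glueReach_walk_split`):
* `(E ∩ F) ∖ B ⊆ {a₀ ↔ b} ∩ M` and `{a₁ ↔ b} ∩ M ⊆ B ∖ (E ∩ F)`, where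
  `M := ({a₁ ↔ v} ∪ {a₁ ↔ x}) ∩ {a₀ ↮ v} ∩ {a₀ ↮ x}` (all in `ω`, i.e. without the pair `e`);
* the exchange inequality `μ({a₀ ↔ b} ∩ M) ≤ μ({a₁ ↔ b} ∩ M)` (`var2411_core`): `M` is the intersection of an
  increasing event of the open cluster `C_{a₁}` and a decreasing event of `C_{a₀}`, and both events lie in
  `D = {a₁ ↮ a₀}`; van den Berg–Häggström–Kahn 2006, Thm. 1.5 (proved in the tree,
  `BHK2006_twoClusterConditionalAssociation_holds`), applied to `(1{a₁ ↔ b}, 1_M)` and to `(1_M, 1{a₀ ↮ b})`,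
  gives `P₁ q ≤ m r₁` and `m r₀ ≤ P₀ q` (`m = μ(D)`, `Pᵢ = μ(D ∩ {aᵢ ↔ b})`, `q = μ(D ∩ M)`,
  `rᵢ = μ({aᵢ ↔ b} ∩ M)`), and `P₀ ≤ P₁` is the minimality of `a₀` (the two connection events agree off `D`).
-/

namespace Summit.CriticalPhenomena.PercolationContinuityZ3.Theorems

open MeasureTheory Set Literature.Probability.LatticeModels Literature.Probability.Percolation
open scoped Classical BigOperators

section Var2411

variable {n : ℕ}

/-- Splitting a path of `insert s(v, x) ω` at the inserted pair: `p ↔ q` there forces, in `ω`, either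
`p ↔ q`, or (`p ↔ v` or `p ↔ x`) together with (`v ↔ q` or `x ↔ q`). [folklore] -/
theorem var2411_insert_reach (ω : BondConfig (Fin n)) (v x p q : Fin n)
    (h : (openGraph (insert s(v, x) ω)).Reachable p q) :
    (openGraph ω).Reachable p q ∨
      (((openGraph ω).Reachable p v ∨ (openGraph ω).Reachable p x) ∧
        ((openGraph ω).Reachable v q ∨ (openGraph ω).Reachable x q)) := by
  have hHG : ∀ c d : Fin n, (openGraph (insert s(v, x) ω)).Adj c d →
      (openGraph ω).Adj c d ∨ (c ∈ ({v, x} : Finset (Fin n)) ∧ d ∈ ({v, x} : Finset (Fin n))) := by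
    intro c d hcd
    rw [openGraph_adj, Set.mem_insert_iff] at hcd
    obtain ⟨h' | h', hne⟩ := hcd
    · right
      rw [Sym2.eq, Sym2.rel_iff'] at h'
      rcases h' with ⟨rfl, rfl⟩ | ⟨rfl, rfl⟩ <;> simp
    · exact Or.inl ((openGraph_adj ω c d).2 ⟨h', hne⟩)
  obtain ⟨wk⟩ := h
  rcases glueReach_walk_split hHG wk with h' | ⟨⟨s, hs, hps⟩, ⟨s', hs', hsq⟩⟩
  · exact Or.inl h'
  · rw [Finset.mem_insert, Finset.mem_singleton] at hs hs'
    refine Or.inr ⟨?_, ?_⟩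
    · rcases hs with rfl | rfl
      · exact Or.inl hps
      · exact Or.inr hps
    · rcases hs' with rfl | rfl
      · exact Or.inl hsq
      · exact Or.inr hsq

/-- Gluing paths through the inserted pair: `v ↔ q` or `x ↔ q` in `ω` gives `v ↔ q` in `insert s(v, x) ω`
(`v ≠ x`). [folklore] -/
theorem var2411_reach_insert (ω : BondConfig (Fin n)) {v x q : Fin n} (hvx : v ≠ x)
    (h : (openGraph ω).Reachable v q ∨ (openGraph ω).Reachable x q) :
    (openGraph (insert s(v, x) ω)).Reachable v q := by
  have hle : openGraph ω ≤ openGraph (insert s(v, x) ω) := openGraph_mono (Set.subset_insert _ _)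
  rcases h with h | h
  · exact h.mono hle
  · have hadj : (openGraph (insert s(v, x) ω)).Adj v x :=
      (openGraph_adj _ v x).2 ⟨Set.mem_insert _ _, hvx⟩
    exact hadj.reachable.trans (h.mono hle)

/-- **The exchange inequality.**  If `P(a₀ ↔ b) ≤ P(a₁ ↔ b)` (`a₀ ≠ a₁`) then, with
`M = ({a₁ ↔ v} ∪ {a₁ ↔ x}) ∩ {a₀ ↮ v} ∩ {a₀ ↮ x}`, `P({a₀ ↔ b} ∩ M) ≤ P({a₁ ↔ b} ∩ M)`: two applications
of van den Berg–Häggström–Kahn 2006, Thm. 1.5 inside `D = {a₁ ↮ a₀}` (see the module docstring).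
[cite: VandenbergHaggstromKahn2005, Thm. 1.5 (p. 7)] -/
theorem var2411_core (w : Sym2 (Fin n) → unitInterval) (a₀ a₁ b v x : Fin n) (h01 : a₀ ≠ a₁)
    (hmin : (prodBernoulli w).real (openConn a₀ b) ≤ (prodBernoulli w).real (openConn a₁ b)) :
    (prodBernoulli w).real (openConn a₀ b ∩
        ((openConn a₁ v ∪ openConn a₁ x) ∩ ((openConn a₀ v)ᶜ ∩ (openConn a₀ x)ᶜ))) ≤
      (prodBernoulli w).real (openConn a₁ b ∩
        ((openConn a₁ v ∪ openConn a₁ x) ∩ ((openConn a₀ v)ᶜ ∩ (openConn a₀ x)ᶜ))) := by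
  set μ := prodBernoulli w with hμ
  set M : Set (BondConfig (Fin n)) :=
    (openConn a₁ v ∪ openConn a₁ x) ∩ ((openConn a₀ v)ᶜ ∩ (openConn a₀ x)ᶜ) with hM
  set Y₀ : Set (BondConfig (Fin n)) := openConn a₀ b with hY₀
  set Y₁ : Set (BondConfig (Fin n)) := openConn a₁ b with hY₁
  set D : Set (BondConfig (Fin n)) := (openConn a₁ a₀)ᶜ with hDdef
  have hD : {ω : BondConfig (Fin n) | ¬ (openGraph ω).Reachable a₁ a₀} = D := rfl
  have h10 : a₁ ≠ a₀ := fun h => h01 h.symm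
  -- membership in `M`, unfolded
  have hMmem : ∀ ω : BondConfig (Fin n), ω ∈ M ↔
      (((openGraph ω).Reachable a₁ v ∨ (openGraph ω).Reachable a₁ x) ∧
        (¬ (openGraph ω).Reachable a₀ v ∧ ¬ (openGraph ω).Reachable a₀ x)) := fun ω => Iff.rfl
  -- the BHK functions of `(C_{a₁}, C_{a₀})`
  have hBHK := BHK2006_twoClusterConditionalAssociation_holds (Fin n) w a₁ a₀
  -- (i) `f = 1{a₁ ↔ b}`, `g = 1_M`
  have key1 := hBHK (fun C _ => connIndicatorFn a₁ b C)
    (fun C C' => if ((v = a₁ ∨ ∃ e ∈ C, v ∈ e) ∨ (x = a₁ ∨ ∃ e ∈ C, x ∈ e)) ∧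
        (¬ (v = a₀ ∨ ∃ e ∈ C', v ∈ e) ∧ ¬ (x = a₀ ∨ ∃ e ∈ C', x ∈ e)) then (1 : ℝ) else 0)
    (fun _ => monotone_connIndicatorFn a₁ b) (fun _ => antitone_const)
    (by
      intro C' C₁ C₂ hC
      dsimp only
      split_ifs with h1 h2 h2
      · exact le_rfl
      · exact absurd ⟨h1.1.imp (Or.imp_right fun ⟨e, he, hve⟩ => ⟨e, hC he, hve⟩)
          (Or.imp_right fun ⟨e, he, hxe⟩ => ⟨e, hC he, hxe⟩), h1.2⟩ h2
      · exact zero_le_one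
      · exact le_rfl)
    (by
      intro C C₁ C₂ hC
      dsimp only
      split_ifs with h1 h2 h2
      · exact le_rfl
      · exact absurd ⟨h1.1, ⟨fun hv => h1.2.1 (hv.imp_right fun ⟨e, he, hve⟩ => ⟨e, hC he, hve⟩),
          fun hx => h1.2.2 (hx.imp_right fun ⟨e, he, hxe⟩ => ⟨e, hC he, hxe⟩)⟩⟩ h2
      · exact zero_le_one
      · exact le_rfl)
    h10
  -- (ii) `f = 1_M`, `g = 1{a₀ ↮ b}`
  have key2 := hBHK
    (fun C C' => if ((v = a₁ ∨ ∃ e ∈ C, v ∈ e) ∨ (x = a₁ ∨ ∃ e ∈ C, x ∈ e)) ∧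
        (¬ (v = a₀ ∨ ∃ e ∈ C', v ∈ e) ∧ ¬ (x = a₀ ∨ ∃ e ∈ C', x ∈ e)) then (1 : ℝ) else 0)
    (fun _ C' => if (b = a₀ ∨ ∃ e ∈ C', b ∈ e) then (0 : ℝ) else 1)
    (by
      intro C' C₁ C₂ hC
      dsimp only
      split_ifs with h1 h2 h2
      · exact le_rfl
      · exact absurd ⟨h1.1.imp (Or.imp_right fun ⟨e, he, hve⟩ => ⟨e, hC he, hve⟩)
          (Or.imp_right fun ⟨e, he, hxe⟩ => ⟨e, hC he, hxe⟩), h1.2⟩ h2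
      · exact zero_le_one
      · exact le_rfl)
    (by
      intro C C₁ C₂ hC
      dsimp only
      split_ifs with h1 h2 h2
      · exact le_rfl
      · exact absurd ⟨h1.1, ⟨fun hv => h1.2.1 (hv.imp_right fun ⟨e, he, hve⟩ => ⟨e, hC he, hve⟩),
          fun hx => h1.2.2 (hx.imp_right fun ⟨e, he, hxe⟩ => ⟨e, hC he, hxe⟩)⟩⟩ h2
      · exact zero_le_one
      · exact le_rfl)
    (fun _ => monotone_const)
    (by
      intro C C₁ C₂ hC
      dsimp only
      split_ifs with h1 h2 h2
      · exact le_rfl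
      · exact zero_le_one
      · exact absurd (h2.imp_right fun ⟨e, he, hbe⟩ => ⟨e, hC he, hbe⟩) h1
      · exact le_rfl)
    h10
  -- evaluate the functions along `(C_{a₁} ω, C_{a₀} ω)`
  have hMω : ∀ ω : BondConfig (Fin n),
      (if ((v = a₁ ∨ ∃ e ∈ openEdgeCluster ω a₁, v ∈ e) ∨ (x = a₁ ∨ ∃ e ∈ openEdgeCluster ω a₁, x ∈ e)) ∧
          (¬ (v = a₀ ∨ ∃ e ∈ openEdgeCluster ω a₀, v ∈ e) ∧
            ¬ (x = a₀ ∨ ∃ e ∈ openEdgeCluster ω a₀, x ∈ e)) then (1 : ℝ) else 0) =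
        M.indicator 1 ω := by
    intro ω
    simp only [← reachable_iff_exists_mem_openEdgeCluster]
    by_cases hω : ω ∈ M
    · rw [if_pos ((hMmem ω).1 hω), Set.indicator_of_mem hω, Pi.one_apply]
    · rw [if_neg (fun h => hω ((hMmem ω).2 h)), Set.indicator_of_notMem hω]
  have hY0cω : ∀ ω : BondConfig (Fin n),
      (if (b = a₀ ∨ ∃ e ∈ openEdgeCluster ω a₀, b ∈ e) then (0 : ℝ) else 1) = Y₀ᶜ.indicator 1 ω := by
    intro ω
    simp only [← reachable_iff_exists_mem_openEdgeCluster]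
    by_cases hω : ω ∈ Y₀
    · rw [if_pos (show (openGraph ω).Reachable a₀ b from hω),
        Set.indicator_of_notMem (fun h : ω ∈ Y₀ᶜ => h hω)]
    · rw [if_neg (show ¬ (openGraph ω).Reachable a₀ b from hω),
        Set.indicator_of_mem (show ω ∈ Y₀ᶜ from hω), Pi.one_apply]
  have hmM : MeasurableSet M := MeasurableSet.of_discrete
  have hmY₀c : MeasurableSet Y₀ᶜ := MeasurableSet.of_discrete
  have hmY₁ : MeasurableSet Y₁ := MeasurableSet.of_discrete
  simp only [connIndicatorFn_openEdgeCluster, hMω, hY0cω, hD] at key1 key2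
  rw [show (fun ω : BondConfig (Fin n) => (openConn a₁ b).indicator (1 : BondConfig (Fin n) → ℝ) ω *
        M.indicator 1 ω) = (Y₁ ∩ M).indicator 1 from
      funext fun ω => (congrFun (Set.inter_indicator_one (s := Y₁) (t := M) (M₀ := ℝ)) ω).symm] at key1
  rw [show (fun ω : BondConfig (Fin n) => M.indicator (1 : BondConfig (Fin n) → ℝ) ω *
        Y₀ᶜ.indicator 1 ω) = (M ∩ Y₀ᶜ).indicator 1 from
      funext fun ω => (congrFun (Set.inter_indicator_one (s := M) (t := Y₀ᶜ) (M₀ := ℝ)) ω).symm] at key2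
  rw [setIntegral_indicator (hmY₁.inter hmM), setIntegral_indicator hmY₁, setIntegral_indicator hmM]
    at key1
  rw [setIntegral_indicator (hmM.inter hmY₀c), setIntegral_indicator hmM, setIntegral_indicator hmY₀c]
    at key2
  simp only [Pi.one_apply, setIntegral_const, smul_eq_mul, mul_one] at key1 key2
  rw [← hμ] at key1 key2
  -- now: key1 : μ(D ∩ Y₁) μ(D ∩ M) ≤ μ(D) μ(D ∩ (Y₁ ∩ M)); key2 : μ(D ∩ M) μ(D ∩ Y₀ᶜ) ≤ μ(D) μ(D ∩ (M ∩ Y₀ᶜ))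
  have hDm : MeasurableSet D := MeasurableSet.of_discrete
  have hmY₀ : MeasurableSet Y₀ := MeasurableSet.of_discrete
  -- `P₀ ≤ P₁`: the two connection events agree off `D`
  have hagree : Y₀ \ D = Y₁ \ D := by
    ext ω
    constructor
    · rintro ⟨h1, h2⟩
      have h2' : (openGraph ω).Reachable a₁ a₀ := not_not.1 h2
      have h1' : (openGraph ω).Reachable a₀ b := h1
      exact ⟨show (openGraph ω).Reachable a₁ b from h2'.trans h1', h2⟩
    · rintro ⟨h1, h2⟩
      have h2' : (openGraph ω).Reachable a₁ a₀ := not_not.1 h2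
      have h1' : (openGraph ω).Reachable a₁ b := h1
      exact ⟨show (openGraph ω).Reachable a₀ b from h2'.symm.trans h1', h2⟩
  have hs0 := measureReal_inter_add_sdiff (μ := μ) (s := Y₀) hDm
  have hs1 := measureReal_inter_add_sdiff (μ := μ) (s := Y₁) hDm
  rw [hagree, Set.inter_comm] at hs0
  rw [Set.inter_comm] at hs1
  have hP : μ.real (D ∩ Y₀) ≤ μ.real (D ∩ Y₁) := by linarith
  -- `μ(D ∩ Y₀ᶜ) = m - P₀`, `μ(D ∩ (M ∩ Y₀ᶜ)) = q - r₀`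
  have hc0 := measureReal_inter_add_sdiff (μ := μ) (s := D) hmY₀
  have hdc0 : D \ Y₀ = D ∩ Y₀ᶜ := Set.ext fun _ => Iff.rfl
  rw [hdc0] at hc0
  have hcM := measureReal_inter_add_sdiff (μ := μ) (s := D ∩ M) hmY₀
  have hdcM : (D ∩ M) \ Y₀ = D ∩ (M ∩ Y₀ᶜ) := Set.ext fun _ => and_assoc
  have hicM : (D ∩ M) ∩ Y₀ = D ∩ (M ∩ Y₀) := Set.inter_assoc D M Y₀
  rw [hdcM, hicM] at hcM
  -- both `Yᵢ ∩ M` lie in `D`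
  have hsubM : M ⊆ D := by
    intro ω hMω' hD'
    have hD'' : (openGraph ω).Reachable a₁ a₀ := hD'
    rcases ((hMmem ω).1 hMω').1 with h | h
    · exact ((hMmem ω).1 hMω').2.1 (hD''.symm.trans h)
    · exact ((hMmem ω).1 hMω').2.2 (hD''.symm.trans h)
  have hsub0 : Y₀ ∩ M ⊆ D := fun ω hω => hsubM hω.2
  have hsub1 : Y₁ ∩ M ⊆ D := fun ω hω => hsubM hω.2
  have he0 : D ∩ (M ∩ Y₀) = Y₀ ∩ M := by
    rw [Set.inter_comm M Y₀, Set.inter_eq_right]; exact hsub0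
  have he1 : D ∩ (Y₁ ∩ M) = Y₁ ∩ M := by
    rw [Set.inter_eq_right]; exact hsub1
  rw [he1] at key1
  rw [he0] at hcM
  -- the algebra
  have hm0 : 0 ≤ μ.real D := measureReal_nonneg
  have hq0 : 0 ≤ μ.real (D ∩ M) := measureReal_nonneg
  have hr0le : μ.real (Y₀ ∩ M) ≤ μ.real D := measureReal_mono hsub0
  rcases eq_or_lt_of_le hm0 with hm | hm
  · calc μ.real (Y₀ ∩ M) ≤ μ.real D := hr0le
      _ = 0 := hm.symm
      _ ≤ μ.real (Y₁ ∩ M) := measureReal_nonneg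
  · -- `m r₀ ≤ P₀ q ≤ P₁ q ≤ m r₁`
    have h2 : μ.real D * μ.real (Y₀ ∩ M) ≤ μ.real (D ∩ Y₀) * μ.real (D ∩ M) := by nlinarith
    have h3 : μ.real (D ∩ Y₀) * μ.real (D ∩ M) ≤ μ.real (D ∩ Y₁) * μ.real (D ∩ M) :=
      mul_le_mul_of_nonneg_right hP hq0
    exact le_of_mul_le_mul_left (h2.trans (h3.trans key1)) hm

/-- TTRL-lite variant V2411 (`A.card = 2`) of the shortening step `stub_shorteningStep` of
stmt-CriticalPhenomena-4574: Kozma–Nitzan's Conjecture 6 (arXiv:2401.12397, (40)) for two relays, against the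
old minimiser `a₀`; the displayed induction hypothesis is not used.  See the module docstring for the proof.
[cite: KozmaNitzan2024, Conjecture 6 (p. 34)] -/
theorem stub_shorteningStep_var2411 :
    ∀ (n : ℕ) (w : Sym2 (Fin n) → unitInterval) (A : Finset (Fin n)) (b v x a₀ : Fin n), A.card = 2 → v ∉ A →
      v ≠ x → w s(v, x) = 0 → a₀ ∈ A →
      (∀ a ∈ A, (prodBernoulli w).real (openConn a₀ b) ≤ (prodBernoulli w).real (openConn a b)) →
      (∀ w' : Sym2 (Fin n) → unitInterval, (∀ e, w e = 0 → w' e = 0) →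
        ∀ (A' : Finset (Fin n)) (o' b' : Fin n) (t : ℝ),
          (∀ a ∈ A', t ≤ (prodBernoulli w').real (openConn a b')) →
          (prodBernoulli w').real (⋃ a ∈ A', openConn o' a) * t ≤
            (prodBernoulli w').real (openConn o' b')) →
      (prodBernoulli (Function.update w s(v, x) 1)).real (⋃ a ∈ A, openConn v a) *
          (prodBernoulli (Function.update w s(v, x) 1)).real (openConn a₀ b) ≤
        (prodBernoulli (Function.update w s(v, x) 1)).real (openConn v b) := by
  intro n w A b v x a₀ hcard _ hvx hw0 ha₀ hmin _
  -- the second relay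
  obtain ⟨a₁, ha₁, h01, hA⟩ : ∃ a₁ ∈ A, a₀ ≠ a₁ ∧ ∀ a ∈ A, a = a₀ ∨ a = a₁ := by
    obtain ⟨p, q, hpq, rfl⟩ := Finset.card_eq_two.1 hcard
    rw [Finset.mem_insert, Finset.mem_singleton] at ha₀
    rcases ha₀ with rfl | rfl
    · exact ⟨q, by simp, hpq, fun a ha => by simpa using ha⟩
    · exact ⟨p, by simp, fun h => hpq h.symm, fun a ha => by
        rcases Finset.mem_insert.1 ha with h | h
        · exact Or.inr h
        · exact Or.inl (Finset.mem_singleton.1 h)⟩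
  have hmin₁ : (prodBernoulli w).real (openConn a₀ b) ≤ (prodBernoulli w).real (openConn a₁ b) :=
    hmin a₁ ha₁
  -- `μ₁ = μ ∘ (insert e)⁻¹`
  have hupd : Function.update w s(v, x) 0 = w := Function.update_eq_self_iff.2 hw0.symm
  rw [tieLiftOne_real_one_eq, tieLiftOne_real_one_eq, tieLiftOne_real_one_eq, hupd]
  set μ := prodBernoulli w with hμ
  set E : Set (BondConfig (Fin n)) :=
    (fun ω : BondConfig (Fin n) => insert s(v, x) ω) ⁻¹' (⋃ a ∈ A, openConn v a) with hE
  set F : Set (BondConfig (Fin n)) :=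
    (fun ω : BondConfig (Fin n) => insert s(v, x) ω) ⁻¹' (openConn a₀ b) with hF
  set B : Set (BondConfig (Fin n)) :=
    (fun ω : BondConfig (Fin n) => insert s(v, x) ω) ⁻¹' (openConn v b) with hB
  set M : Set (BondConfig (Fin n)) :=
    (openConn a₁ v ∪ openConn a₁ x) ∩ ((openConn a₀ v)ᶜ ∩ (openConn a₀ x)ᶜ) with hM
  have hMmem : ∀ ω : BondConfig (Fin n), ω ∈ M ↔
      (((openGraph ω).Reachable a₁ v ∨ (openGraph ω).Reachable a₁ x) ∧
        (¬ (openGraph ω).Reachable a₀ v ∧ ¬ (openGraph ω).Reachable a₀ x)) := fun ω => Iff.rfl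
  -- Harris
  have hEup : IsUpperSet E := by
    intro ω ω' hle hω
    have hω' : insert s(v, x) ω ∈ ⋃ a ∈ A, (openConn v a : Set (BondConfig (Fin n))) := hω
    simp only [Set.mem_iUnion, exists_prop] at hω'
    obtain ⟨a, ha, hva⟩ := hω'
    show insert s(v, x) ω' ∈ ⋃ a ∈ A, (openConn v a : Set (BondConfig (Fin n)))
    simp only [Set.mem_iUnion, exists_prop]
    exact ⟨a, ha, isUpperSet_openConn v a (Set.insert_subset_insert hle) hva⟩
  have hFup : IsUpperSet F := fun ω ω' hle hω =>
    isUpperSet_openConn a₀ b (Set.insert_subset_insert hle) hω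
  have hharris : μ.real E * μ.real F ≤ μ.real (E ∩ F) :=
    prodBernoulli_harris w hEup hFup MeasurableSet.of_discrete MeasurableSet.of_discrete
  -- the two inclusions
  have hinc1 : (E ∩ F) \ B ⊆ openConn a₀ b ∩ M := by
    rintro ω ⟨⟨hωE, hωF⟩, hωB⟩
    have hvb : ¬ (openGraph ω).Reachable v b := fun h => hωB (var2411_reach_insert ω hvx (Or.inl h))
    have hxb : ¬ (openGraph ω).Reachable x b := fun h => hωB (var2411_reach_insert ω hvx (Or.inr h))
    have h0b : (openGraph ω).Reachable a₀ b := by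
      rcases var2411_insert_reach ω v x a₀ b hωF with h | ⟨_, h | h⟩
      · exact h
      · exact absurd h hvb
      · exact absurd h hxb
    have h0v : ¬ (openGraph ω).Reachable a₀ v := fun h => hvb (h.symm.trans h0b)
    have h0x : ¬ (openGraph ω).Reachable a₀ x := fun h => hxb (h.symm.trans h0b)
    refine ⟨h0b, (hMmem ω).2 ⟨?_, h0v, h0x⟩⟩
    have hωE' : insert s(v, x) ω ∈ ⋃ a ∈ A, (openConn v a : Set (BondConfig (Fin n))) := hωE
    simp only [Set.mem_iUnion, exists_prop] at hωE'
    obtain ⟨a, ha, hva⟩ := hωE'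
    rcases hA a ha with rfl | rfl
    · exfalso
      rcases var2411_insert_reach ω v x v a hva with h | ⟨_, h | h⟩
      · exact h0v h.symm
      · exact h0v h.symm
      · exact h0x h.symm
    · rcases var2411_insert_reach ω v x v a hva with h | ⟨_, h | h⟩
      · exact Or.inl h.symm
      · exact Or.inl h.symm
      · exact Or.inr h.symm
  have hinc2 : openConn a₁ b ∩ M ⊆ B \ (E ∩ F) := by
    rintro ω ⟨h1b, hωM⟩
    obtain ⟨hQ, h0v, h0x⟩ := (hMmem ω).1 hωM
    have h1b' : (openGraph ω).Reachable a₁ b := h1b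
    refine ⟨?_, ?_⟩
    · show (openGraph (insert s(v, x) ω)).Reachable v b
      rcases hQ with h | h
      · exact var2411_reach_insert ω hvx (Or.inl (h.symm.trans h1b'))
      · exact var2411_reach_insert ω hvx (Or.inr (h.symm.trans h1b'))
    · rintro ⟨-, hωF⟩
      rcases var2411_insert_reach ω v x a₀ b hωF with h | ⟨h | h, _⟩
      · rcases hQ with h' | h'
        · exact h0v (h.trans (h1b'.symm.trans h'))
        · exact h0x (h.trans (h1b'.symm.trans h'))
      · exact h0v h
      · exact h0x h
  -- assemble
  have hcore := var2411_core w a₀ a₁ b v x h01 hmin₁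
  have hBm : MeasurableSet B := MeasurableSet.of_discrete
  have hEFm : MeasurableSet (E ∩ F) := MeasurableSet.of_discrete
  have hs1 := measureReal_inter_add_sdiff (μ := μ) (s := E ∩ F) hBm
  have hs2 := measureReal_inter_add_sdiff (μ := μ) (s := B) hEFm
  rw [Set.inter_comm] at hs2
  have h3 : μ.real ((E ∩ F) \ B) ≤ μ.real (openConn a₀ b ∩ M) := measureReal_mono hinc1
  have h4 : μ.real (openConn a₁ b ∩ M) ≤ μ.real (B \ (E ∩ F)) := measureReal_mono hinc2
  linarith

end Var2411

end Summit.CriticalPhenomena.PercolationContinuityZ3.Theorems
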